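import Summits.BirchSwinnertonDyer.BirchSwinnertonDyer.Theses.KolyvaginRankRigidityAtTwo
import Summits.BirchSwinnertonDyer.BirchSwinnertonDyer.Theorems.KolyvaginRankRigidityAtTwoWindowInduction
import HarnessLib

/-!
# Crux V2♭θ / V2♭∞ (line `kolyvagin_depth_split`): Kolyvagin's induction at `2` from a LOSSY prime
# swap and a RICH seed (robust sequel of `…SwapInduction`, p619681)

p619681 assumed the swap LOSSLESS (same exponent `j` after the swap). The bit ledger at `2` (crux-dir
memo `SWAP-LEDGER.md`): in the WINDOW phase (old and new primes fresh, same index band and Frobenius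
type) the two surviving reciprocity terms have the same shape and the swap is lossless; in the SEED
phase (old = given seed prime of lower index / other type) the Sah bit and the type bit need not
cancel, so a swap may cost a CONSTANT `c₂` bits. `windowsRich_of_lossySwap`: from (SWAP-L) the swap
with output exponent `j − c₂`, (CHEB), (LOC↑), (GLOB↑) as in p619681, a RICH seed at depth `ν` (for
EVERY `θ, k` a non-zero class of depth `ν` with `θ·M₀ + k ≤ M(n₀)` — Kolyvagin's strong non-zero
system at depth `ν`, Math. Ann. 291 (2.1)) and `(θ, k)`-minimality below `ν` for SOME `(θ, k)`, the
registered T5⁺ conclusion (`f = ν`); the lead takes the seed with `θ = 2`,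
`k = c₀ + 2c₁ + (2ν + 2)c₂ + 1`, paying `c₂` bits for each of the `2ν + 1` swaps. HONEST FRAMING: the
hypotheses at `2` are NOT proved here; nothing here proves V2♭θ, V2♭∞ or BSD.
-/

set_option autoImplicit false
-- the Theorems namespace of this sub repeats the summit name by design (D-0017 nested layout)
set_option linter.dupNamespace false

noncomputable section

open scoped Classical

open WeierstrassCurve Literature.NumberTheory.EllipticCurves
  Literature.NumberTheory.EllipticCurves.ModularForms NumberField IsDedekindDomain
open Summit.BirchSwinnertonDyer.BirchSwinnertonDyer.Theses.KolyvaginRankRigidityAtTwo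

namespace Summit.BirchSwinnertonDyer.BirchSwinnertonDyer.Theorems.KolyvaginLowerBoundAtTwo

/-- The prime factors of a product of distinct primes. [folklore] -/
private theorem primeFactors_prod_primes₁ {s : Finset ℕ} (hs : ∀ p ∈ s, p.Prime) :
    (∏ p ∈ s, p).primeFactors = s :=
  Nat.primeFactors_prod hs

/-- A product of distinct primes is square-free. [folklore] -/
private theorem squarefree_prod_primes₁ {s : Finset ℕ} (hs : ∀ p ∈ s, p.Prime) :
    Squarefree (∏ p ∈ s, p) := by
  refine Finset.squarefree_prod_of_pairwise_isCoprime (fun a ha b hb hab ↦ ?_)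
    fun p hp ↦ (hs p hp).squarefree
  simp only [← Nat.coprime_iff_isRelPrime]
  exact (Nat.coprime_primes (hs a ha) (hs b hb)).mpr hab

/-- Removing one prime from a product of distinct primes. [folklore] -/
private theorem prod_primes_div₁ {s : Finset ℕ} (hs : ∀ p ∈ s, p.Prime) {ℓ : ℕ} (hℓ : ℓ ∈ s) :
    (∏ p ∈ s, p) / ℓ = ∏ p ∈ s.erase ℓ, p := by
  refine Nat.div_eq_of_eq_mul_right (hs ℓ hℓ).pos ?_
  rw [Finset.mul_prod_erase s (fun p ↦ p) hℓ]

/-- A prime dividing a product of distinct primes is one of them. [folklore] -/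
private theorem mem_of_prime_dvd_prod_primes {s : Finset ℕ} (hs : ∀ p ∈ s, p.Prime) {q : ℕ}
    (hq : q.Prime) (hdvd : q ∣ ∏ p ∈ s, p) : q ∈ s := by
  have h : q ∈ (∏ p ∈ s, p).primeFactors :=
    Nat.mem_primeFactors.mpr ⟨hq, hdvd, (squarefree_prod_primes₁ hs).ne_zero⟩
  rwa [primeFactors_prod_primes₁ hs] at h

/-- Smaller powers stay outside a subgroup. [folklore] -/
private theorem pow_smul_not_mem_of_le {A : Type*} [AddCommGroup A] (H : AddSubgroup A) (x : A)
    {e j : ℕ} (hej : e ≤ j) (hj : ((2 ^ j : ℕ) : ℤ) • x ∉ H) : ((2 ^ e : ℕ) : ℤ) • x ∉ H := by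
  intro he
  apply hj
  have : ((2 ^ j : ℕ) : ℤ) = ((2 ^ (j - e) : ℕ) : ℤ) * ((2 ^ e : ℕ) : ℤ) := by
    rw [← Nat.cast_mul, ← pow_add, Nat.sub_add_cancel hej]
  rw [this, mul_smul]
  exact H.zsmul_mem he _

/-- Transport of a datum along an equality of conductors keeps its classes. [folklore] -/
private theorem kolyvaginClass_cast {W : WeierstrassCurve ℚ} [W.IsGloballyMinimal] {K : Type}
    [Field K] [NumberField K] [NeZero (W.conductorNorm ℤ)]
    {Dt : ModularParametrizationData W (W.conductorNorm ℤ)} {β : ℤ} {ι : K →+* ℂ} {n n' : ℕ}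
    (e : n = n') (d : KolyvaginHeegnerData Dt β ι n) (M : ℕ) :
    (e ▸ d).kolyvaginClass Nat.prime_two M = d.kolyvaginClass Nat.prime_two M := by
  subst e; rfl


section Induction

variable (W : WeierstrassCurve ℚ) [W.IsGloballyMinimal] (K : Type) [Field K] [NumberField K]
  [NeZero (W.conductorNorm ℤ)]
  (Dt : ModularParametrizationData W (W.conductorNorm ℤ)) (β : ℤ) (ι : K →+* ℂ)

/-- **Kolyvagin's windows at every level from a LOSSY prime swap and a RICH seed** (Math. Ann. 291,
proof of Thm. 2.2, made formal at `2`): see the module docstring. Hypotheses `hswap` (SWAP-L: output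
exponent `j − c₂`), `hcheb` (CHEB, constant `c₁`), `hlocUp` (LOC↑), `hglobUp` (GLOB↑); rich seed of
depth `ν ≥ 1` (`∀ θ k`, a non-zero class with `θ M₀ + k ≤ M(n₀)`); `(θ, k)`-minimality below depth
`ν` for some `(θ, k)`. Conclusion: the registered T5⁺ conclusion with `f = ν`.
[cite: Kolyvagin1991MathAnn, §2, proof of Thm. 2.2, p. 257 (2m(λ₀) < n(λ₀)) and p. 259 (2.1)]
[cite: WZhang2014, Lemma 8.4 (2)] -/
theorem windowsRich_of_lossySwap (c₀ c₁ c₂ : ℕ)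
    (hswap : ∀ (M I : ℕ) (T : Finset ℕ) (a : ℕ)
      (dat : KolyvaginHeegnerData Dt β ι (∏ p ∈ T, p)) (j : ℕ) (X : Finset ℕ),
      1 ≤ M → M + 1 ≤ I →
      (∀ p ∈ T, Zhang2014.IsKolyvaginPrime (W.conductorNorm ℤ) W K 2 p ∧
        M + 1 ≤ Zhang2014.kolyvaginIndex W 2 p) →
      a ∈ T → M + c₀ ≤ 2 * j →
      (∀ X' : Finset ℕ, ∃ q : ℕ, q ∉ X' ∧ Zhang2014.IsKolyvaginPrime (W.conductorNorm ℤ) W K 2 q ∧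
        I ≤ Zhang2014.kolyvaginIndex W 2 q ∧
        ∃ v : HeightOneSpectrum (𝓞 K), ((q : ℕ) : 𝓞 K) ∈ v.asIdeal ∧
          ((2 ^ j : ℕ) : ℤ) • dat.kolyvaginClass Nat.prime_two M ∉
            (W.baseChange K).torsionLocalKer (v.adicCompletion K) ((2 ^ M : ℕ) : ℤ)) →
      ∃ ℓ : ℕ, ℓ ∉ X ∧ ℓ ∉ T ∧ Zhang2014.IsKolyvaginPrime (W.conductorNorm ℤ) W K 2 ℓ ∧
        I ≤ Zhang2014.kolyvaginIndex W 2 ℓ ∧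
        (∃ v : HeightOneSpectrum (𝓞 K), ((ℓ : ℕ) : 𝓞 K) ∈ v.asIdeal ∧
          ((2 ^ j : ℕ) : ℤ) • dat.kolyvaginClass Nat.prime_two M ∉
            (W.baseChange K).torsionLocalKer (v.adicCompletion K) ((2 ^ M : ℕ) : ℤ)) ∧
        ∃ dat' : KolyvaginHeegnerData Dt β ι (∏ p ∈ insert ℓ (T.erase a), p),
          ∀ X' : Finset ℕ, ∃ q : ℕ, q ∉ X' ∧
            Zhang2014.IsKolyvaginPrime (W.conductorNorm ℤ) W K 2 q ∧
            I ≤ Zhang2014.kolyvaginIndex W 2 q ∧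
            ∃ v : HeightOneSpectrum (𝓞 K), ((q : ℕ) : 𝓞 K) ∈ v.asIdeal ∧
              ((2 ^ (j - c₂) : ℕ) : ℤ) • dat'.kolyvaginClass Nat.prime_two M ∉
                (W.baseChange K).torsionLocalKer (v.adicCompletion K) ((2 ^ M : ℕ) : ℤ))
    (hcheb : ∀ (n : ℕ) (dat : KolyvaginHeegnerData Dt β ι n) (M m I : ℕ),
      KolyvaginDescent.KolSupp (Zhang2014.IsKolyvaginPrime (W.conductorNorm ℤ) W K 2) n →
      1 ≤ M → (M : ℕ∞) ≤ Zhang2014.levelIndex W 2 n → M ≤ I → c₁ ≤ m →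
      ((2 ^ m : ℕ) : ℤ) • dat.kolyvaginClass Nat.prime_two M ≠ 0 →
      ∀ X' : Finset ℕ, ∃ q : ℕ, q ∉ X' ∧ Zhang2014.IsKolyvaginPrime (W.conductorNorm ℤ) W K 2 q ∧
        I ≤ Zhang2014.kolyvaginIndex W 2 q ∧
        ∃ v : HeightOneSpectrum (𝓞 K), ((q : ℕ) : 𝓞 K) ∈ v.asIdeal ∧
          ((2 ^ (m - c₁) : ℕ) : ℤ) • dat.kolyvaginClass Nat.prime_two M ∉
            (W.baseChange K).torsionLocalKer (v.adicCompletion K) ((2 ^ M : ℕ) : ℤ))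
    (hlocUp : ∀ (n : ℕ) (dat : KolyvaginHeegnerData Dt β ι n) (M M' j q : ℕ)
      (v : HeightOneSpectrum (𝓞 K)),
      KolyvaginDescent.KolSupp (Zhang2014.IsKolyvaginPrime (W.conductorNorm ℤ) W K 2) n →
      1 ≤ M → M ≤ M' → (M' : ℕ∞) ≤ Zhang2014.levelIndex W 2 n →
      Zhang2014.IsKolyvaginPrime (W.conductorNorm ℤ) W K 2 q → M' ≤ Zhang2014.kolyvaginIndex W 2 q →
      ¬ q ∣ n → ((q : ℕ) : 𝓞 K) ∈ v.asIdeal →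
      ((2 ^ j : ℕ) : ℤ) • dat.kolyvaginClass Nat.prime_two M ∉
        (W.baseChange K).torsionLocalKer (v.adicCompletion K) ((2 ^ M : ℕ) : ℤ) →
      ((2 ^ (j + (M' - M)) : ℕ) : ℤ) • dat.kolyvaginClass Nat.prime_two M' ∉
        (W.baseChange K).torsionLocalKer (v.adicCompletion K) ((2 ^ M' : ℕ) : ℤ))
    (hglobUp : ∀ (n : ℕ) (dat : KolyvaginHeegnerData Dt β ι n) (M M' j : ℕ),
      KolyvaginDescent.KolSupp (Zhang2014.IsKolyvaginPrime (W.conductorNorm ℤ) W K 2) n →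
      1 ≤ M → M ≤ M' → (M' : ℕ∞) ≤ Zhang2014.levelIndex W 2 n →
      ((2 ^ j : ℕ) : ℤ) • dat.kolyvaginClass Nat.prime_two M ≠ 0 →
      ((2 ^ (j + (M' - M)) : ℕ) : ℤ) • dat.kolyvaginClass Nat.prime_two M' ≠ 0)
    (ν : ℕ) (hν : 1 ≤ ν)
    (hrich : ∀ θ k : ℕ, ∃ (n₀ : ℕ) (d₀ : KolyvaginHeegnerData Dt β ι n₀) (M₀ : ℕ),
      KolyvaginDescent.KolSupp (Zhang2014.IsKolyvaginPrime (W.conductorNorm ℤ) W K 2) n₀ ∧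
      n₀.primeFactors.card = ν ∧ 1 ≤ M₀ ∧
      ((θ * M₀ + k : ℕ) : ℕ∞) ≤ Zhang2014.levelIndex W 2 n₀ ∧
      d₀.kolyvaginClass Nat.prime_two M₀ ≠ 0)
    (hmin : ∃ θ k : ℕ, ∀ (n' : ℕ) (d' : KolyvaginHeegnerData Dt β ι n') (M' : ℕ),
      KolyvaginDescent.KolSupp (Zhang2014.IsKolyvaginPrime (W.conductorNorm ℤ) W K 2) n' →
      1 ≤ M' → ((θ * M' + k : ℕ) : ℕ∞) ≤ Zhang2014.levelIndex W 2 n' →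
      n'.primeFactors.card < ν → d'.kolyvaginClass Nat.prime_two M' = 0) :
    ∃ f dd : ℕ, ν ≤ f ∧ ∀ M : ℕ, 1 ≤ M →
      ∃ (S : Fin (f + 1) → Finset ℕ) (q : Fin (f + 1) → ℕ)
        (v : Fin (f + 1) → HeightOneSpectrum (𝓞 K))
        (dat : (i : Fin (f + 1)) → KolyvaginHeegnerData Dt β ι (∏ p ∈ S i, p)),
        (∀ i, (S i).card = f) ∧
        (∀ i, ∀ p ∈ S i, Zhang2014.IsKolyvaginPrime (W.conductorNorm ℤ) W K 2 p ∧
          M + 1 ≤ Zhang2014.kolyvaginIndex W 2 p) ∧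
        (∀ i j : Fin (f + 1), j < i → q j ∈ S i) ∧
        (∀ i, ((q i : ℕ) : 𝓞 K) ∈ (v i).asIdeal) ∧
        (∀ i, ∀ ℓ ∈ S i, ∀ d₀ : KolyvaginHeegnerData Dt β ι ((∏ p ∈ S i, p) / ℓ),
          d₀.kolyvaginClass Nat.prime_two M = 0) ∧
        (∀ (i : Fin (f + 1)) (e : ℕ), e + dd < M →
          ((2 ^ e : ℕ) : ℤ) • (dat i).kolyvaginClass Nat.prime_two M ∉
            (W.baseChange K).torsionLocalKer ((v i).adicCompletion K) ((2 ^ M : ℕ) : ℤ)) := by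
  set N := W.conductorNorm ℤ with hN
  obtain ⟨θ, kθ, hmin⟩ := hmin
  -- the seed: relative margin `(2, k)` with `k` paying for the `2ν + 1` lossy swaps
  set k : ℕ := c₀ + 2 * c₁ + 2 * ν * c₂ + 2 * c₂ + 1 with hk
  obtain ⟨n₀, d₀, M₀, hn₀, hcard₀, hM₀, hidx₀, hne₀⟩ := hrich 2 k
  -- the seed's top working level `M* = 2 M₀ + k - 1` and the constants of the construction
  set Ms : ℕ := 2 * M₀ + k - 1 with hMs
  have hMs1 : 1 ≤ Ms := by omega
  have hM₀Ms : M₀ ≤ Ms := by omega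
  have hidxMs : ∀ p ∈ n₀.primeFactors, Ms + 1 ≤ Zhang2014.kolyvaginIndex W 2 p := by
    intro p hp
    have h := (Zhang2014.natCast_le_levelIndex_iff.mp hidx₀) p hp
    omega
  have hlevMs : ((Ms : ℕ) : ℕ∞) ≤ Zhang2014.levelIndex W 2 n₀ :=
    le_trans (by exact_mod_cast (by omega : Ms ≤ 2 * M₀ + k)) hidx₀
  -- the exponent `j` at the start of the walk at level `M*`; it drops by `c₂` per swap
  set m : ℕ := Ms - M₀ with hm
  have hc₁m : c₁ ≤ m := by omega
  set j : ℕ := m - c₁ with hj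
  have hjν : ν * c₂ ≤ j := by
    have : ν * c₂ ≤ 2 * ν * c₂ := by nlinarith
    omega
  have hrel : ∀ c ≤ ν, Ms + c₀ ≤ 2 * (j - (ν - c) * c₂) := by
    intro c hc
    have h1 : (ν - c) * c₂ ≤ ν * c₂ := Nat.mul_le_mul_right c₂ (Nat.sub_le ν c)
    have h2 : 2 * ν * c₂ = 2 * (ν * c₂) := by ring
    omega
  -- the seed class at level `M*` is `2^m`-large (GLOB↑)
  have hneMs : ((2 ^ m : ℕ) : ℤ) • d₀.kolyvaginClass Nat.prime_two Ms ≠ 0 := by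
    have h := hglobUp n₀ d₀ M₀ Ms 0 hn₀ hM₀ hM₀Ms hlevMs
      (by simpa only [pow_zero, Nat.cast_one, one_smul] using hne₀)
    simpa [hm] using h
  -- the exponent after the `ν` seed swaps, and the constants of the conclusion
  set jν : ℕ := j - ν * c₂ with hjν'
  set M₁ : ℕ := 2 * Ms + c₀ + 2 * (ν + 1) * c₂ with hM₁
  refine ⟨ν, M₁ + Ms + ν * c₂, le_rfl, fun M hM ↦ ?_⟩
  -- the working level `M̂ = max M M₁` and the index `I` of the fresh primes
  set Mh : ℕ := max M M₁ with hMh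
  have hMhM : M ≤ Mh := le_max_left _ _
  have hMhM₁ : M₁ ≤ Mh := le_max_right _ _
  have hMh1 : 1 ≤ Mh := le_trans hM hMhM
  have hMsMh : Ms ≤ Mh := by omega
  set I : ℕ := θ * Mh + kθ + Mh + Ms + 1 with hI
  have hIMh : Mh + 1 ≤ I := by omega
  have hIMs : Ms + 1 ≤ I := by omega
  have hIθ : θ * M + kθ ≤ I := by
    have : θ * M ≤ θ * Mh := Nat.mul_le_mul_left θ hMhM
    omega
  -- ### Stage 1: the seed as a window, and the walk replacing its primes (level `M*`)
  set T₀ : Finset ℕ := n₀.primeFactors with hT₀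
  have hT₀prime : ∀ p ∈ T₀, p.Prime := fun p hp ↦ Nat.prime_of_mem_primeFactors hp
  have hprod₀ : ∏ p ∈ T₀, p = n₀ := Nat.prod_primeFactors_of_squarefree hn₀.1
  -- invariant of the walk: `c` old primes remain, exponent `j - (ν - c) c₂`
  have walk : ∀ c : ℕ, c ≤ ν → ∀ (T : Finset ℕ) (dat : KolyvaginHeegnerData Dt β ι (∏ p ∈ T, p)),
      T.card = ν →
      (∀ p ∈ T, Zhang2014.IsKolyvaginPrime N W K 2 p ∧ Ms + 1 ≤ Zhang2014.kolyvaginIndex W 2 p) →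
      (∀ p ∈ T, p ∉ T₀ → I ≤ Zhang2014.kolyvaginIndex W 2 p) →
      (T ∩ T₀).card = c →
      (∀ X' : Finset ℕ, ∃ q : ℕ, q ∉ X' ∧ Zhang2014.IsKolyvaginPrime N W K 2 q ∧
        I ≤ Zhang2014.kolyvaginIndex W 2 q ∧
        ∃ v : HeightOneSpectrum (𝓞 K), ((q : ℕ) : 𝓞 K) ∈ v.asIdeal ∧
          ((2 ^ (j - (ν - c) * c₂) : ℕ) : ℤ) • dat.kolyvaginClass Nat.prime_two Ms ∉
            (W.baseChange K).torsionLocalKer (v.adicCompletion K) ((2 ^ Ms : ℕ) : ℤ)) →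
      ∃ (T' : Finset ℕ) (dat' : KolyvaginHeegnerData Dt β ι (∏ p ∈ T', p)),
        T'.card = ν ∧
        (∀ p ∈ T', Zhang2014.IsKolyvaginPrime N W K 2 p ∧ I ≤ Zhang2014.kolyvaginIndex W 2 p) ∧
        (∀ X' : Finset ℕ, ∃ q : ℕ, q ∉ X' ∧ Zhang2014.IsKolyvaginPrime N W K 2 q ∧
          I ≤ Zhang2014.kolyvaginIndex W 2 q ∧
          ∃ v : HeightOneSpectrum (𝓞 K), ((q : ℕ) : 𝓞 K) ∈ v.asIdeal ∧
            ((2 ^ jν : ℕ) : ℤ) • dat'.kolyvaginClass Nat.prime_two Ms ∉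
              (W.baseChange K).torsionLocalKer (v.adicCompletion K) ((2 ^ Ms : ℕ) : ℤ)) := by
    intro c
    induction c with
    | zero =>
      intro _ T dat hcard hKol hfresh hc hBig
      refine ⟨T, dat, hcard, fun p hp ↦ ⟨(hKol p hp).1, hfresh p hp ?_⟩, ?_⟩
      · intro hpT₀
        have : p ∈ T ∩ T₀ := Finset.mem_inter.mpr ⟨hp, hpT₀⟩
        rw [Finset.card_eq_zero] at hc
        simp [hc] at this
      · simpa only [hjν', Nat.sub_zero] using hBig
    | succ c ih =>
      intro hcν T dat hcard hKol hfresh hc hBig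
      -- an old prime `a ∈ T ∩ T₀` to drop
      obtain ⟨a, ha⟩ : (T ∩ T₀).Nonempty := by
        rw [← Finset.card_pos, hc]; exact Nat.succ_pos c
      obtain ⟨haT, haT₀⟩ := Finset.mem_inter.mp ha
      -- SWAP at level `M*`, the new prime outside `T ∪ T₀`
      obtain ⟨ℓ, hℓX, hℓT, hℓKol, hℓI, -, dat', hBig'⟩ :=
        hswap Ms I T a dat (j - (ν - (c + 1)) * c₂) (T ∪ T₀) hMs1 hIMs hKol haT
          (hrel (c + 1) hcν) hBig
      have hℓT₀ : ℓ ∉ T₀ := fun h ↦ hℓX (Finset.mem_union_right _ h)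
      have hexp : j - (ν - (c + 1)) * c₂ - c₂ = j - (ν - c) * c₂ := by
        have h1 : (ν - c) * c₂ = (ν - (c + 1)) * c₂ + c₂ := by
          have : ν - c = (ν - (c + 1)) + 1 := by omega
          rw [this, Nat.add_mul, one_mul]
        omega
      refine ih (by omega) (insert ℓ (T.erase a)) dat' ?_ ?_ ?_ ?_ (by rw [← hexp]; exact hBig')
      · rw [Finset.card_insert_of_notMem (fun h ↦ hℓT (Finset.mem_of_mem_erase h)),
          Finset.card_erase_of_mem haT, hcard]
        omega
      · intro p hp
        rcases Finset.mem_insert.mp hp with rfl | hp'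
        · exact ⟨hℓKol, by omega⟩
        · exact hKol p (Finset.mem_of_mem_erase hp')
      · intro p hp hpT₀
        rcases Finset.mem_insert.mp hp with rfl | hp'
        · exact hℓI
        · exact hfresh p (Finset.mem_of_mem_erase hp') hpT₀
      · -- the number of old primes drops by one
        have h1 : insert ℓ (T.erase a) ∩ T₀ = (T ∩ T₀).erase a := by
          ext p
          simp only [Finset.mem_inter, Finset.mem_insert, Finset.mem_erase]
          constructor
          · rintro ⟨hp | ⟨hpa, hpT⟩, hpT₀⟩
            · exact absurd (hp ▸ hpT₀) hℓT₀
            · exact ⟨hpa, hpT, hpT₀⟩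
          · rintro ⟨hpa, hpT, hpT₀⟩
            exact ⟨Or.inr ⟨hpa, hpT⟩, hpT₀⟩
        rw [h1, Finset.card_erase_of_mem ha, hc]
        omega
  -- the seed window (transport `d₀` along `∏ T₀ = n₀`) and its largeness at level `M*` (CHEB)
  obtain ⟨Tf, datf, hTfcard, hTfKol, hBigf⟩ :
      ∃ (T' : Finset ℕ) (dat' : KolyvaginHeegnerData Dt β ι (∏ p ∈ T', p)),
        T'.card = ν ∧
        (∀ p ∈ T', Zhang2014.IsKolyvaginPrime N W K 2 p ∧ I ≤ Zhang2014.kolyvaginIndex W 2 p) ∧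
        (∀ X' : Finset ℕ, ∃ q : ℕ, q ∉ X' ∧ Zhang2014.IsKolyvaginPrime N W K 2 q ∧
          I ≤ Zhang2014.kolyvaginIndex W 2 q ∧
          ∃ v : HeightOneSpectrum (𝓞 K), ((q : ℕ) : 𝓞 K) ∈ v.asIdeal ∧
            ((2 ^ jν : ℕ) : ℤ) • dat'.kolyvaginClass Nat.prime_two Ms ∉
              (W.baseChange K).torsionLocalKer (v.adicCompletion K) ((2 ^ Ms : ℕ) : ℤ)) := by
    -- the seed datum on the conductor `∏ T₀ = n₀`
    let d₀' : KolyvaginHeegnerData Dt β ι (∏ p ∈ T₀, p) := hprod₀.symm ▸ d₀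
    have hcl : ∀ M' : ℕ, d₀'.kolyvaginClass Nat.prime_two M' = d₀.kolyvaginClass Nat.prime_two M' :=
      fun M' ↦ kolyvaginClass_cast hprod₀.symm d₀ M'
    refine walk ν le_rfl T₀ d₀' hcard₀ (fun p hp ↦ ⟨hn₀.2 p hp, hidxMs p hp⟩)
      (fun p hp hpT₀ ↦ absurd hp hpT₀) (by rw [Finset.inter_self]; exact hcard₀) ?_
    intro X'
    obtain ⟨q, hqX, hqKol, hqI, v, hv, hloc⟩ :=
      hcheb _ d₀ Ms m I hn₀ hMs1 hlevMs (by omega) hc₁m hneMs X'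
    refine ⟨q, hqX, hqKol, hqI, v, hv, ?_⟩
    rw [hcl, Nat.sub_self, Nat.zero_mul, Nat.sub_zero]
    exact hloc
  have hTfprime : ∀ p ∈ Tf, p.Prime := fun p hp ↦ (hTfKol p hp).1.1
  have hTfsupp : KolyvaginDescent.KolSupp (Zhang2014.IsKolyvaginPrime N W K 2) (∏ p ∈ Tf, p) :=
    ⟨squarefree_prod_primes₁ hTfprime, fun p hp ↦
      (hTfKol p (by rwa [primeFactors_prod_primes₁ hTfprime] at hp)).1⟩
  have hTflev : ((Mh : ℕ) : ℕ∞) ≤ Zhang2014.levelIndex W 2 (∏ p ∈ Tf, p) := by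
    rw [Zhang2014.natCast_le_levelIndex_iff]
    intro p hp
    rw [primeFactors_prod_primes₁ hTfprime] at hp
    have := (hTfKol p hp).2
    omega
  -- ### Stage 2: raise the level to `M̂` (LOC↑); the exponent becomes `j' = jν + (M̂ - M*)`
  set j' : ℕ := jν + (Mh - Ms) with hj'
  have hrel' : ∀ kk ≤ ν, Mh + c₀ ≤ 2 * (j' - kk * c₂) := by
    intro kk hkk
    have h1 : kk * c₂ ≤ ν * c₂ := Nat.mul_le_mul_right c₂ hkk
    have h2 : 2 * (ν + 1) * c₂ = 2 * (ν * c₂) + 2 * c₂ := by ring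
    omega
  have hBigh : ∀ X' : Finset ℕ, ∃ q : ℕ, q ∉ X' ∧ Zhang2014.IsKolyvaginPrime N W K 2 q ∧
      I ≤ Zhang2014.kolyvaginIndex W 2 q ∧
      ∃ v : HeightOneSpectrum (𝓞 K), ((q : ℕ) : 𝓞 K) ∈ v.asIdeal ∧
        ((2 ^ j' : ℕ) : ℤ) • datf.kolyvaginClass Nat.prime_two Mh ∉
          (W.baseChange K).torsionLocalKer (v.adicCompletion K) ((2 ^ Mh : ℕ) : ℤ) := by
    intro X'
    obtain ⟨q, hqX, hqKol, hqI, v, hv, hloc⟩ := hBigf (X' ∪ Tf)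
    refine ⟨q, fun h ↦ hqX (Finset.mem_union_left _ h), hqKol, hqI, v, hv, ?_⟩
    have hqTf : q ∉ Tf := fun h ↦ hqX (Finset.mem_union_right _ h)
    have hqdvd : ¬ q ∣ ∏ p ∈ Tf, p := fun h ↦
      hqTf (mem_of_prime_dvd_prod_primes hTfprime hqKol.1 h)
    exact hlocUp _ datf Ms Mh jν q v hTfsupp hMs1 hMsMh hTflev hqKol (by omega) hqdvd hv hloc
  -- ### Stage 3: the windows at level `M̂` (abstract window induction, landed; exponent drops by `c₂` a step)
  set jmin : ℕ := j' - ν * c₂ with hjmin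
  obtain ⟨b, q, hbcard, hbAdm, hinc, hLoc⟩ := exists_windows_of_step
    (Dat := fun S ↦ KolyvaginHeegnerData Dt β ι (∏ p ∈ S, p)) ν hν
    (fun p ↦ Zhang2014.IsKolyvaginPrime N W K 2 p ∧ I ≤ Zhang2014.kolyvaginIndex W 2 p)
    (fun kk bb ↦ ∀ X' : Finset ℕ, ∃ q : ℕ, q ∉ X' ∧ Zhang2014.IsKolyvaginPrime N W K 2 q ∧
      I ≤ Zhang2014.kolyvaginIndex W 2 q ∧
      ∃ v : HeightOneSpectrum (𝓞 K), ((q : ℕ) : 𝓞 K) ∈ v.asIdeal ∧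
        ((2 ^ (j' - kk * c₂) : ℕ) : ℤ) • bb.2.kolyvaginClass Nat.prime_two Mh ∉
          (W.baseChange K).torsionLocalKer (v.adicCompletion K) ((2 ^ Mh : ℕ) : ℤ))
    (fun bb p ↦ ∃ v : HeightOneSpectrum (𝓞 K), ((p : ℕ) : 𝓞 K) ∈ v.asIdeal ∧
      ((2 ^ jmin : ℕ) : ℤ) • bb.2.kolyvaginClass Nat.prime_two Mh ∉
        (W.baseChange K).torsionLocalKer (v.adicCompletion K) ((2 ^ Mh : ℕ) : ℤ))
    ⟨⟨Tf, datf⟩, hTfcard, hTfKol, by simpa only [Nat.zero_mul, Nat.sub_zero] using hBigh⟩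
    (by
      intro kk bb a hkk hcard hAdm ha hOrd
      have hKol : ∀ p ∈ bb.1, Zhang2014.IsKolyvaginPrime N W K 2 p ∧
          Mh + 1 ≤ Zhang2014.kolyvaginIndex W 2 p :=
        fun p hp ↦ ⟨(hAdm p hp).1, le_trans hIMh (hAdm p hp).2⟩
      obtain ⟨ℓ, -, hℓT, hℓKol, hℓI, ⟨v, hv, hℓLoc⟩, dat', hBig'⟩ :=
        hswap Mh I bb.1 a bb.2 (j' - kk * c₂) bb.1 hMh1 hIMh hKol ha (hrel' kk hkk) hOrd
      have hexp : j' - kk * c₂ - c₂ = j' - (kk + 1) * c₂ := by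
        rw [Nat.add_mul, one_mul, Nat.sub_sub]
      refine ⟨ℓ, hℓT, ⟨hℓKol, hℓI⟩, ⟨v, hv, ?_⟩, dat', by rw [← hexp]; exact hBig'⟩
      exact pow_smul_not_mem_of_le _ _
        (by have := Nat.mul_le_mul_right c₂ hkk; omega : jmin ≤ j' - kk * c₂) hℓLoc)
  choose v hv hvloc using hLoc
  -- ### Reading off the registered conclusion at level `M`
  have hSprime : ∀ i, ∀ p ∈ (b i).1, p.Prime := fun i p hp ↦ (hbAdm i p hp).1.1
  refine ⟨fun i ↦ (b i).1, q, v, fun i ↦ (b i).2, hbcard, fun i p hp ↦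
    ⟨(hbAdm i p hp).1, le_trans (by omega) (hbAdm i p hp).2⟩, hinc, hv, ?_, ?_⟩
  · -- sub-window classes vanish at level `M`: (θ, kθ)-minimality (index `≥ I ≥ θ M + kθ`, depth `ν - 1`)
    intro i ℓ hℓ d₀
    have hdiv : (∏ p ∈ (b i).1, p) / ℓ = ∏ p ∈ ((b i).1).erase ℓ, p := prod_primes_div₁ (hSprime i) hℓ
    have hprime' : ∀ p ∈ ((b i).1).erase ℓ, p.Prime := fun p hp ↦
      hSprime i p (Finset.mem_of_mem_erase hp)
    refine hmin _ d₀ M ?_ hM ?_ ?_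
    · rw [hdiv]
      exact ⟨squarefree_prod_primes₁ hprime', fun p hp ↦ by
        rw [primeFactors_prod_primes₁ hprime'] at hp
        exact (hbAdm i p (Finset.mem_of_mem_erase hp)).1⟩
    · rw [hdiv, Zhang2014.natCast_le_levelIndex_iff]
      intro p hp
      rw [primeFactors_prod_primes₁ hprime'] at hp
      exact le_trans hIθ (hbAdm i p (Finset.mem_of_mem_erase hp)).2
    · rw [hdiv, primeFactors_prod_primes₁ hprime', Finset.card_erase_of_mem hℓ, hbcard i]
      omega
  · -- diagonal: for `e + dd < M` we are at level `M̂ = M` and `e ≤ jmin`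
    intro i e he
    have hMM₁ : M₁ ≤ M := by omega
    have hMhM' : Mh = M := by rw [hMh]; exact max_eq_left hMM₁
    have hej : e ≤ jmin := by omega
    have h := pow_smul_not_mem_of_le _ _ hej (hvloc i)
    rw [hMhM'] at h
    exact h

end Induction

end Summit.BirchSwinnertonDyer.BirchSwinnertonDyer.Theorems.KolyvaginLowerBoundAtTwo

end
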